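import Summits.FinalStateConjecture.FinalStateConjecture.Theses.TangentConeAtIPlus
import Summits.FinalStateConjecture.FinalStateConjecture.Theorems.UniversalWitnessFamily.Negative.MinkowskiSettled
import Summits.FinalStateConjecture.FinalStateConjecture.Theorems.WeakCosmicCensorshipMGHD.Negative.LoadBearing
import Literature.Geometry.Lorentzian.CompleteDevelopmentMaximal
import HarnessLib

/-!
# `ConeCompletesScri` (crux stmt-FinalStateConjecture-17670, route TangentConeAtIPlus) — negative-side
# lemmas I: readback of the let-inlined cone predicate and the model point (anti-vacuity at the one
# certified MGHD)

Refuter seat `refuter-rattack-stmt-FinalStateConjecture-17670-0` (crux-attack vetting, 2026-08-17).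
Small-model facts for the crux `ConeCompletesScri` ("cone data ⇒ complete `𝓘⁺` in the sojourn form"):

* `ConePred` — the route file's `let Cone := …` predicate (identical text in K1–K4) as a named `def`,
  and `coneCompletesScri_iff` — the crux IS `∀ admissible D, ∀ MGHD 𝒟, ∀ cone data, ConePred … →
  HasCompleteNullInfinity 𝒟` (by `Iff.rfl`: the readback is literal).
* `conePred_minkowski` — **the hypothesis block of the crux is inhabited at a development of an
  admissible datum**: the `N = 0` cone data (identity flat chart on `U = E4`, `T = 0`, no world-line,
  no tube) satisfy every clause of `Cone` in the Minkowski development of the trivial datum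
  `(ℝ³, δ, 0)` — orthochronicity / continuity / drift / disjointness / basin clauses are vacuous over
  `Fin 0`, the covering clause is `⊆ univ`, the late-chart clause is the tree's
  `isLateChart_idFlatChart` transported along `J⁺({x⁰ = 0}) = {x⁰ ≥ 0}`
  (`causalFuture_range_sliceEmbed`), `Φ₊∂₀ = ∂ₜ` is future-directed (`mfderiv_subtypeVal`), and both
  flatness clauses hold with deviation `≡ 0` (`deviationExtend_idFlatChart`).
* `coneCompletesScri_hypotheses_minkowski` — given the Choquet-Bruhat–Geroch existence theorem
  (`choquetBruhat_geroch_exists_mghd_cauchy`, a named fact of the tree, used only for `IsMaximal`),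
  ALL hypotheses of the crux (admissible datum, `IsMaximal`, cone data) hold together at ONE certified
  maximal development, and so does its conclusion (`minkowski_hasCompleteNullInfinity`): the crux is
  non-vacuous and consistent at the dispersal end (`N = 0`).
* `coneCompletesScri_minkowski` — the crux's instance at the Minkowski development holds outright
  (for every cone data on it), unconditionally.

Nothing here closes the item. `sorry`-free; Mathlib + landed tree modules; no named fact introduced.

References: Christodoulou–Klainerman 1993, Thm. 1.0.2 (Minkowski space as the trivial final state);
Christodoulou, CQG 16 (1999), pp. A26–A27 (intrinsic completeness of `𝓘⁺`); Choquet-Bruhat–Geroch,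
CMP 14 (1969), Thm. 3; DHRT arXiv:2104.08222, §1 (late-time charts).
-/

noncomputable section

set_option linter.dupNamespace false

open scoped BigOperators Topology Manifold Classical ContDiff ENNReal
open Filter Set Function TopologicalSpace

namespace Summit.FinalStateConjecture.FinalStateConjecture.Theorems.ConeCompletesScri.Negative

open Literature.Geometry.Lorentzian
open Summit.FinalStateConjecture.FinalStateConjecture.Theses.TangentConeAtIPlus (ConeCompletesScri)
open Summit.FinalStateConjecture.FinalStateConjecture.Theorems.UniversalWitnessFamily.Negative
  (minkowskiExterior idFlatChart isLateChart_idFlatChart deviationExtend_idFlatChart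
    causalFuture_range_sliceEmbed)
open Summit.FinalStateConjecture.FinalStateConjecture.Theorems.WeakCosmicCensorshipMGHD.Negative
  (minkowski_hasCompleteNullInfinity)

/-! ## §1 Readback of the cone predicate -/

/-- **The cone predicate of route TangentConeAtIPlus** (verbatim the `let Cone := …` shared by the
items K1–K4 of the route file): `N` straight world-lines `(Λᵢ, cᵢ)` with orthochronous `Λᵢ`,
continuous sublinear near-zone radii `σᵢ → ∞` and drifts `dᵢ`, pairwise disjoint drifted tubes after
flat time `T`, a flat late chart `Φ : U → M` on `U ⊇ {x⁰ > T} ∖ ⋃ tubes` into `J⁺(S)` with `Φ₊∂₀`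
future-directed, weighted `C²`-flatness in the timelike interior off the rays, plain `C²`-flatness on
the full slabs, and the basin clause (each island recurrently `ε`-close to one fixed sub-extremal
boosted Kerr). A parametrised predicate (readback of the route's hypothesis), not a named fact.
[cite: DafermosLuk2017, Conjecture 1] -/
def ConePred (𝓢 : Spacetime.{0} 4) (S : Set 𝓢.carrier) (N : ℕ) (mo : Fin N → lorentzGroup × E4)
    (σ : Fin N → ℝ → ℝ) (dr : Fin N → ℝ → E4) (T : ℝ) (U : Opens E4) (Φ : U → 𝓢.carrier) : Prop :=
  let t := fun i (x : E4) => poincareInv (mo i).1 (mo i).2 x 0; let d := fun i (x : E4) => E4.spatialNorm (poincareInv (mo i).1 (mo i).2 x); let tube := fun i (w : ℝ) => (fun x ↦ x + dr i (t i x)) '' {x : E4 | d i x ≤ σ i (t i x) + w} ∩ {y | T < y 0}; let F := Minkowski.backgroundOn U; (∀ i, Summit.FinalStateConjecture.IsOrthochronous (mo i).1 ∧ Continuous (σ i) ∧ Continuous (dr i) ∧ Tendsto (fun s : ℝ ↦ (|σ i s| + ‖dr i s‖) / s) atTop (𝓝 0) ∧ Tendsto (σ i) atTop atTop) ∧ (∀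 i j, i ≠ j → Disjoint (tube i 5) (tube j 5)) ∧ {y : E4 | T < y 0} \ (⋃ i, tube i 0) ⊆ (U : Set E4) ∧ 𝓢.IsLateChart F (𝓢.metric.causalFuture 𝓢.timeOrientation S) T Φ ∧ (∀ x : U, 𝓢.timeOrientation.IsFutureDirected (mfderiv 𝓘(ℝ, E4) (𝓡 4) Φ x (EuclideanSpace.single 0 1))) ∧ (∀ δ : ℝ, 0 < δ → Tendsto (fun τ : ℝ ↦ weightedCkSeminorm {x : E4 | x 0 = τ ∧ E4.spatialNorm x ≤ (1 - δ) * τ ∧ ∀ i, δ * τ ≤ d i x} 2 0 (𝓢.deviationExtend F Φ)) atTop (𝓝 0)) ∧ Tendsto (fun τ : ℝ ↦ 𝓢.deviationCk F Φ 2 τ) atTop (𝓝 0) ∧ (∀ i, ∃ M a : ℝ, Kerr.IsSubextremal M a ∧ ∀ ε : ENNReal, 0 < ε → ∀ τ₁ : ℝ, ∃ τ : ℝ, τ₁ ≤ τ ∧ (let B := boostedKerrBackground (mo i).1 (mo i).2 M a; ∃ Ψ : B.domain → 𝓢.carrier, ContMDiff 𝓘(ℝ, E4) (𝓡 4) ∞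 Ψ ∧ Topology.IsOpenEmbedding ({x : B.domain | |t i x.1 - τ| < 1 ∧ d i x.1 < σ i (t i x.1) + |a| + 6}.restrict Ψ) ∧ (∀ x : B.domain, |t i x.1 - τ| < 1 → σ i (t i x.1) + 1 ≤ d i x.1 → d i x.1 < σ i (t i x.1) + 4 → ∃ hx : x.1 + dr i (t i x.1) ∈ (U : Set E4), Ψ x = Φ ⟨_, hx⟩) ∧ 𝓢.truncDeviationCk B Ψ 2 (σ i τ + 5) τ ≤ ε))

/-- **Readback**: the crux `ConeCompletesScri` is literally "for every admissible datum, every MGHD and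
every cone data (`ConePred`), the development has complete future null infinity in the sojourn form"
(definitional unfolding of the route file's `let`). [cite: Christodoulou1999, pp. A26–A27] -/
theorem coneCompletesScri_iff :
    ConeCompletesScri ↔
      ∀ (X : Type) [TopologicalSpace X] [ChartedSpace E3 X] [IsManifold (𝓡 3) ∞ X] [T2Space X]
        [SecondCountableTopology X] [ConnectedSpace X] (D : InitialDataSet (𝓡 3) X),
        D ∈ admissibleVacuumData X → ∀ 𝒟 : VacuumCauchyDevelopment D, 𝒟.IsMaximal →
          ∀ (N : ℕ) (mo : Fin N → lorentzGroup × E4) (σ : Fin N → ℝ → ℝ) (dr : Fin N → ℝ → E4)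
            (T : ℝ) (U : Opens E4) (Φ : U → 𝒟.carrier),
            ConePred 𝒟.toSpacetime (range 𝒟.embed) N mo σ dr T U Φ →
              Summit.FinalStateConjecture.HasCompleteNullInfinity 𝒟.toCauchyDevelopment :=
  Iff.rfl

/-! ## §2 The model point: `N = 0` cone data on the Minkowski development -/

/-- **The `N = 0` cone data of Minkowski space**: in the Minkowski development of the trivial datum,
the identity flat chart on `U = E4` with `T = 0` and no world-line satisfies every clause of the cone
predicate (`S = ι(ℝ³) = {x⁰ = 0}`, so `J⁺(S) = {x⁰ ≥ 0}` receives the late region `{x⁰ > 0}`;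
`Φ₊∂₀ = ∂ₜ`; deviation `Φ^*η − η ≡ 0`). Christodoulou–Klainerman 1993, Thm. 1.0.2 (Minkowski space is
its own, flat, tangent cone at `i⁺`). [cite: ChristodoulouKlainerman1993, Thm. 1.0.2] -/
theorem conePred_minkowski :
    ConePred Minkowski.spacetime (range Minkowski.sliceEmbed) 0 Fin.elim0 Fin.elim0 Fin.elim0 0 ⊤
      idFlatChart := by
  dsimp only [ConePred]
  refine ⟨fun i ↦ i.elim0, fun i ↦ i.elim0, fun y _ ↦ trivial, ?_, ?_, ?_, ?_, fun i ↦ i.elim0⟩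
  · -- late chart into `J⁺(ι ℝ³) = {x⁰ ≥ 0}`
    rw [causalFuture_range_sliceEmbed]
    exact isLateChart_idFlatChart
  · -- `Φ₊∂₀ = ∂ₜ` is future-directed for the time orientation `∂ₜ` of Minkowski spacetime
    intro x
    change Minkowski.spacetime.timeOrientation.IsFutureDirected
      (mfderiv 𝓘(ℝ, E4) (𝓡 4) idFlatChart x (EuclideanSpace.single 0 1))
    have hd : mfderiv 𝓘(ℝ, E4) (𝓡 4) idFlatChart x (EuclideanSpace.single 0 1) =
        EuclideanSpace.single 0 1 := by
      change mfderiv 𝓘(ℝ, E4) 𝓘(ℝ, E4) (Subtype.val : (⊤ : Opens E4) → E4) x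
        (EuclideanSpace.single 0 1) = _
      rw [mfderiv_subtypeVal]
      rfl
    rw [hd]
    exact Minkowski.spacetime.timeOrientation.isFutureDirected_vectorField (x : E4)
  · -- weighted interior flatness: the deviation vanishes identically
    intro δ _
    simp_rw [deviationExtend_idFlatChart, weightedCkSeminorm_zero]
    exact tendsto_const_nhds
  · -- plain `C²` flatness on the slabs
    have h : ∀ τ, Minkowski.spacetime.deviationCk (Minkowski.backgroundOn ⊤) idFlatChart 2 τ = 0 :=
      fun τ ↦ by rw [Spacetime.deviationCk, deviationExtend_idFlatChart, supCkENorm_zero]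
    simp_rw [h]
    exact tendsto_const_nhds

/-- **Anti-vacuity and consistency of the crux at one certified MGHD.** Given the Choquet-Bruhat–Geroch
existence theorem (used only to certify maximality of the Minkowski development,
`Minkowski.isMaximal_vacuumCauchyDevelopment`): the trivial datum is admissible, the Minkowski
development is maximal, the `N = 0` identity cone data satisfy the crux's hypothesis `ConePred`, AND
the crux's conclusion (complete `𝓘⁺`, sojourn form) holds there. [cite: ChoquetBruhatGeroch1969CMP, Thm. 3] -/
theorem coneCompletesScri_hypotheses_minkowski (hcbg : choquetBruhat_geroch_exists_mghd_cauchy) :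
    trivialData ∈ admissibleVacuumData Minkowski.slice ∧
      Minkowski.vacuumCauchyDevelopment.IsMaximal ∧
        ConePred Minkowski.vacuumCauchyDevelopment.toSpacetime
            (range Minkowski.vacuumCauchyDevelopment.embed) 0 Fin.elim0 Fin.elim0 Fin.elim0 0 ⊤
            idFlatChart ∧
          Summit.FinalStateConjecture.HasCompleteNullInfinity
            Minkowski.vacuumCauchyDevelopment.toCauchyDevelopment :=
  ⟨trivialData_mem_admissibleVacuumData, Minkowski.isMaximal_vacuumCauchyDevelopment hcbg,
    conePred_minkowski, minkowski_hasCompleteNullInfinity⟩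

/-- **The hypothesis block of the crux is satisfiable by a development of an admissible datum**
(unconditional form, without maximality): some admissible datum has a vacuum Cauchy development
carrying cone data. [cite: ChristodoulouKlainerman1993, Thm. 1.0.2] -/
theorem exists_conePred_admissible :
    ∃ (X : Type) (_ : TopologicalSpace X) (_ : ChartedSpace E3 X) (_ : IsManifold (𝓡 3) ∞ X)
      (_ : T2Space X) (_ : SecondCountableTopology X) (_ : ConnectedSpace X)
      (D : InitialDataSet (𝓡 3) X) (_ : D ∈ admissibleVacuumData X) (𝒟 : VacuumCauchyDevelopment D)
      (N : ℕ) (mo : Fin N → lorentzGroup × E4) (σ : Fin N → ℝ → ℝ) (dr : Fin N → ℝ → E4) (T : ℝ)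
      (U : Opens E4) (Φ : U → 𝒟.carrier), ConePred 𝒟.toSpacetime (range 𝒟.embed) N mo σ dr T U Φ :=
  ⟨Minkowski.slice, inferInstance, inferInstance, inferInstance, inferInstance, inferInstance,
    inferInstance, trivialData, trivialData_mem_admissibleVacuumData, Minkowski.vacuumCauchyDevelopment,
    0, Fin.elim0, Fin.elim0, Fin.elim0, 0, ⊤, idFlatChart, conePred_minkowski⟩

/-- **The crux holds at the Minkowski development, for every cone data on it** (its conclusion does
not depend on the cone data, and Minkowski space has complete `𝓘⁺`:
`minkowski_hasCompleteNullInfinity`). Christodoulou, CQG 16 (1999), p. A27. [cite: Christodoulou1999, p. A27] -/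
theorem coneCompletesScri_minkowski (N : ℕ) (mo : Fin N → lorentzGroup × E4) (σ : Fin N → ℝ → ℝ)
    (dr : Fin N → ℝ → E4) (T : ℝ) (U : Opens E4) (Φ : U → Minkowski.vacuumCauchyDevelopment.carrier)
    (_h : ConePred Minkowski.vacuumCauchyDevelopment.toSpacetime
      (range Minkowski.vacuumCauchyDevelopment.embed) N mo σ dr T U Φ) :
    Summit.FinalStateConjecture.HasCompleteNullInfinity
      Minkowski.vacuumCauchyDevelopment.toCauchyDevelopment :=
  minkowski_hasCompleteNullInfinity

end Summit.FinalStateConjecture.FinalStateConjecture.Theorems.ConeCompletesScri.Negative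

end
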